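import Summits.Ventures.PercRepro.Night2BasisMass
import Summits.Ventures.PercRepro.Night2GoodTwoColumnSide

/-!
# night-2: the (2,1) cell of h21 reduced to one counting statement per lossy basis pair

With the floors of `cap3` by target type (`Night2BasisFloors`) and the mass bound by the number of lossy bases inside
a target (`Night2BasisMass`), the basis pairs' fair share — the last hypothesis of `localShadowHall_of_gt2` in cell
`(2, 1)` with at most one fat closure — follows from the TYPED COUNT SUM
`221/360 ≤ Σ_{T ∈ tgtSets B z} vType T / #(lossy five-point subsets of T ∖ K)` at every lossy basis pair `(B, z)`
(`basis_pair_fair_of_count_sum`; `vType T` = `1` when `|G ∖ T| ≤ 1`, `max 0 (11/18 − L1 T)` at an unloaded target, `0` at a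
loaded one), and the local Hall inequality of the cell from these count sums alone
(`localShadowHall_of_count_sums`) — paper NIGHT-2-g31 §3.
-/

namespace PercRepro.Shadow

open PercRepro.ThmH PercRepro.PerFlat

variable {α : Type*} [DecidableEq α] {M : Matroid α} [M.Finite] {G : Finset α}

/-- **The basis pairs' fair share from floors and lossy-basis counts**: for a lossy basis pair `(B, z)`, floors
`0 ≤ v T ≤ cap3 T` at its targets and `221/360 ≤ Σ_T v T / cnt T` (`cnt T` = the number of lossy five-point subsets
of `T ∖ K`) give `loss B z ≤ rhoL B z · lossIncomeH B z`. -/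
theorem basis_pair_fair_of_floors_of_lossy_count (hG : G ∈ flatsQ M (5 + 1)) (hd : (gr M \ G).card = 2)
    (hk : kColoops M G = 1) (hs : ∀ e ∈ gr M, ∀ f ∈ gr M, e ≠ f → rkN M {e, f} = 2)
    (hl : ∀ e ∈ gr M, M.Indep {e}) (hfat : (fatClosures M 5 G 2).card ≤ 1)
    {B : Finset α} (hB : B ∈ thinMembers M 5 G) (hnP : ¬ bigP M G B) {z : α} (hz : z ∈ G \ clF M B)
    (hl0 : loss M 5 G B z ≠ 0) (v : Finset α → ℚ)
    (hv0 : ∀ T ∈ tgtSets M 5 G B z, 0 ≤ v T)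
    (hv : ∀ T ∈ tgtSets M 5 G B z, v T ≤ cap3 M 5 G (bigP M G) (dshGT2 M 5 G) T)
    (hsum : 221 / 360 ≤ ∑ T ∈ tgtSets M 5 G B z,
      v T / ((((T \ coloops M G).powersetCard 5).filter (fun Q' => lossyBasis M G Q')).card : ℚ)) :
    loss M 5 G B z ≤ rhoL M 5 G B z * lossIncomeH M 5 G (bigP M G) (dshGT2 M 5 G) B z := by
  have hd' : (gr M \ G).card ≤ 5 := by omega
  have hB4 := card_sdiff_eq_four_of_not_bigP hG hd hk hB hnP
  set D : ℚ := ((2 ^ (G.card - 6) - 1 : ℕ) : ℚ) with hD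
  have hDpos : 0 < D := by
    rw [hD]
    have h7 : 7 ≤ G.card := by
      have hKB : coloops M G ⊆ B := coloops_subset_of_mem_thinMembers hG hd' hB
      have hBG : B ⊆ G := subset_G_of_mem_thinMembers hB
      have h1 := Finset.card_sdiff_add_card_eq_card hKB
      rw [← kColoops_eq_card_coloops, hk] at h1
      have h2 := two_le_card_sdiff_of_not_lay0 hG hd' (mem_thinMembers.1 hB).1 (mem_thinMembers.1 hB).2
      have hdisj : Disjoint B (G \ clF M B) := by
        rw [Finset.disjoint_left]
        intro a ha ha'
        exact (Finset.mem_sdiff.1 ha').2 (subset_clF_of_subset_gr (hBG.trans (mem_flatsQ.1 hG).1) ha)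
      have h3 := Finset.card_le_card (Finset.union_subset hBG (Finset.sdiff_subset : G \ clF M B ⊆ G))
      rw [Finset.card_union_of_disjoint hdisj] at h3
      omega
    have : 2 ≤ 2 ^ (G.card - 6) := by
      calc 2 = 2 ^ 1 := by norm_num
        _ ≤ 2 ^ (G.card - 6) := Nat.pow_le_pow_right (by norm_num) (by omega)
    exact_mod_cast (by omega : 0 < 2 ^ (G.card - 6) - 1)
  have hrho : rhoL M 5 G B z = loss M 5 G B z / D := by
    unfold rhoL
    rw [card_tgtSets hG (mem_thinMembers.1 hB).1 hz,
      card_sdiff_insert_eq_dqm1 (ρ := 5) hG hd' hB (by omega) hz, hk]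
    have hcard : G.card - 1 - 5 = G.card - 6 := by omega
    rw [hcard]
  have hcard : ((tgtSets M 5 G B z).card : ℚ) = D := by
    rw [card_tgtSets hG (mem_thinMembers.1 hB).1 hz,
      card_sdiff_insert_eq_dqm1 (ρ := 5) hG hd' hB (by omega) hz, hk]
    have hcard : G.card - 1 - 5 = G.card - 6 := by omega
    rw [hcard]
  -- the mass bound `u`
  set u : Finset α → ℚ := fun T =>
    ((((T \ coloops M G).powersetCard 5).filter (fun Q' => lossyBasis M G Q')).card : ℚ) * ((221 / 360) / D) with hu
  have hmass : ∀ T ∈ tgtSets M 5 G B z, pi2MassH M 5 G (bigP M G) T ≤ u T := fun T hT =>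
    pi2MassH_le_lossy_count hG hd hk hfat (subset_G_of_mem_shadowAt (mem_tgtSets.1 hT).1)
  have hinc := lossIncomeH_ge_of_subfamily hG hd' (column_side_gt2 hG hd hk hs hl hfat) hB hnP hz hl0
    (Finset.Subset.refl _) u v hmass hv hv0
  -- `Σ v / u = (D / (221/360)) · Σ v / cnt ≥ D`
  have hsplit : ∑ T ∈ tgtSets M 5 G B z, v T / u T = (D / (221 / 360)) * ∑ T ∈ tgtSets M 5 G B z,
      v T / ((((T \ coloops M G).powersetCard 5).filter (fun Q' => lossyBasis M G Q')).card : ℚ) := by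
    rw [Finset.mul_sum]
    apply Finset.sum_congr rfl
    intro T _
    simp only [hu]
    by_cases hc : ((((T \ coloops M G).powersetCard 5).filter (fun Q' => lossyBasis M G Q')).card : ℚ) = 0
    · rw [hc]
      simp
    · field_simp
  have hD' : D ≤ ∑ T ∈ tgtSets M 5 G B z, v T / u T := by
    rw [hsplit]
    have := mul_le_mul_of_nonneg_left hsum (le_of_lt (div_pos hDpos (by norm_num : (0 : ℚ) < 221 / 360)))
    calc D = D / (221 / 360) * (221 / 360) := by field_simp
      _ ≤ _ := this
  rw [hrho]
  have hloss0 : 0 ≤ loss M 5 G B z := loss_nonneg (le_trans (by norm_num)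
    (capS_ge_eleven_eighteenths_two_one hd hk (Finset.insert_subset (Finset.mem_sdiff.1 hz).1
      (subset_G_of_mem_thinMembers hB))))
  calc loss M 5 G B z = loss M 5 G B z / D * D := by field_simp
    _ ≤ loss M 5 G B z / D * lossIncomeH M 5 G (bigP M G) (dshGT2 M 5 G) B z := by
        apply mul_le_mul_of_nonneg_left (hD'.trans hinc)
        exact div_nonneg hloss0 hDpos.le

/-- The proof-grade floor of `cap3` (routing `dshGT2`) at a target: `1` when at most one point of `G` is off it;
`max 0 (11/18 − L1 T)` at an unloaded target (`cap3 = cap2 ≥ capS − L1`); `0` at a loaded target. -/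
noncomputable def vType (M : Matroid α) [M.Finite] (G T : Finset α) : ℚ :=
  if (G \ T).card ≤ 1 then 1
  else if dload M 5 G (bigP M G) (dshGT2 M 5 G) T = 0 then max 0 (11 / 18 - L1 M 5 G T)
  else 0

/-- The typed floor is nonnegative. -/
theorem vType_nonneg (T : Finset α) : 0 ≤ vType M G T := by
  unfold vType
  split_ifs
  · norm_num
  · exact le_max_left _ _
  · exact le_refl _

/-- **The typed floor is a floor of `cap3`.** -/
theorem vType_le_cap3 (hG : G ∈ flatsQ M (5 + 1)) (hd : (gr M \ G).card = 2) (hk : kColoops M G = 1)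
    (hs : ∀ e ∈ gr M, ∀ f ∈ gr M, e ≠ f → rkN M {e, f} = 2) (hl : ∀ e ∈ gr M, M.Indep {e})
    (hfat : (fatClosures M 5 G 2).card ≤ 1) {T : Finset α} (hTG : T ⊆ G) (hKT : coloops M G ⊆ T) :
    vType M G T ≤ cap3 M 5 G (bigP M G) (dshGT2 M 5 G) T := by
  have hd' : (gr M \ G).card ≤ 5 := by omega
  have hcol := dload_gt2_le_cap2 hG hd hk hs hl hfat hTG hKT
  unfold vType
  split_ifs with h1 h2
  · rw [cap3_gt2_eq_one_of_card_sdiff_le_one hG hd h1]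
  · unfold cap3
    rw [h2, sub_zero]
    have h3 := capS_ge_eleven_eighteenths_two_one hd hk hTG
    have h4 := cap2_ge_capS_sub_L1_of_le hG hd' T
    rw [h2] at hcol
    apply max_le hcol
    linarith
  · unfold cap3
    linarith

/-- **THE REMAINING STATEMENT OF h21, EXPLICIT**: the basis pairs' fair share holds at every lossy basis pair whose
typed count sum `Σ_T vType T / (number of lossy bases inside T)` reaches `221/360`. -/
theorem basis_pair_fair_of_count_sum (hG : G ∈ flatsQ M (5 + 1)) (hd : (gr M \ G).card = 2)
    (hk : kColoops M G = 1) (hs : ∀ e ∈ gr M, ∀ f ∈ gr M, e ≠ f → rkN M {e, f} = 2)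
    (hl : ∀ e ∈ gr M, M.Indep {e}) (hfat : (fatClosures M 5 G 2).card ≤ 1)
    {B : Finset α} (hB : B ∈ thinMembers M 5 G) (hnP : ¬ bigP M G B) {z : α} (hz : z ∈ G \ clF M B)
    (hl0 : loss M 5 G B z ≠ 0)
    (hsum : 221 / 360 ≤ ∑ T ∈ tgtSets M 5 G B z,
      vType M G T / ((((T \ coloops M G).powersetCard 5).filter (fun Q' => lossyBasis M G Q')).card : ℚ)) :
    loss M 5 G B z ≤ rhoL M 5 G B z * lossIncomeH M 5 G (bigP M G) (dshGT2 M 5 G) B z :=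
  basis_pair_fair_of_floors_of_lossy_count hG hd hk hs hl hfat hB hnP hz hl0 (vType M G)
    (fun _ _ => vType_nonneg _)
    (fun _ hT => vType_le_cap3 hG hd hk hs hl hfat (subset_G_of_mem_shadowAt (mem_tgtSets.1 hT).1)
      (coloops_subset_of_mem_shadowAt (mem_tgtSets.1 hT).1)) hsum

/-- **The (2,1) cell of h21 from the typed count sums alone.** -/
theorem localShadowHall_of_count_sums (hG : G ∈ flatsQ M (5 + 1)) (hd : (gr M \ G).card = 2)
    (hk : kColoops M G = 1) (hs : ∀ e ∈ gr M, ∀ f ∈ gr M, e ≠ f → rkN M {e, f} = 2)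
    (hl : ∀ e ∈ gr M, M.Indep {e}) (hfat : (fatClosures M 5 G 2).card ≤ 1)
    (hsum : ∀ B ∈ thinMembers M 5 G, ¬ bigP M G B → ∀ z ∈ G \ clF M B, loss M 5 G B z ≠ 0 →
      221 / 360 ≤ ∑ T ∈ tgtSets M 5 G B z,
        vType M G T / ((((T \ coloops M G).powersetCard 5).filter (fun Q' => lossyBasis M G Q')).card : ℚ)) :
    LocalShadowHall M 5 G := by
  apply localShadowHall_of_gt2_of_basis_fair hG hd hk hs hl hfat
  intro B hB hnP z hz
  by_cases hl0 : loss M 5 G B z = 0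
  · rw [hl0]
    have hd' : (gr M \ G).card ≤ 5 := by omega
    have h1 : 0 ≤ rhoL M 5 G B z := by
      unfold rhoL
      rw [hl0]
      simp
    have h2 : 0 ≤ lossIncomeH M 5 G (bigP M G) (dshGT2 M 5 G) B z :=
      lossIncomeH_nonneg hG hd' (column_side_gt2 hG hd hk hs hl hfat) B z
    positivity
  · exact basis_pair_fair_of_count_sum hG hd hk hs hl hfat hB hnP hz hl0 (hsum B hB hnP z hz hl0)

end PercRepro.Shadow
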